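import Literature.AlgebraicTopology.SingularHomology.FiniteCoverTransferComparison
import HarnessLib

/-!
# The transpose swap for correspondence operators of finite coverings

For finite coverings (tree `IsFiniteCover`, normalised transfers `τ'`) `f₁, g : E → B`, `f₁', g' : E' → B` and a
finite covering `φ : E → E'` onto a preconnected space with `g = f₁' ∘ φ` and `f₁ = g' ∘ φ`:
**`τ'_g ∘ f₁^* = τ'_{f₁'} ∘ g'^*`** (`IsFiniteCover.transferMap_comp_map_eq_of_comp`) — from the composition law
`τ'_{f₁' ∘ φ} = τ'_{f₁'} ∘ τ'_φ` (`IsFiniteCover.transferMap_comp`, `FiniteCoverTransferComparison`) and `τ'_φ ∘ φ^* = id`.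
Applied to a Hecke pair `(f₁, g)` over `Γ ∩ γ⁻¹Γγ`, the pair `(f₁', g')` over `Γ ∩ γΓγ⁻¹` and the Hecke translation
`φ = [v] ↦ [γ v]` between them, this is the geometric form of `ᵗ(Γ γ Γ) = Γ γ⁻¹ Γ`: the transpose `τ'_g ∘ f₁^*` of the
Hecke operator of `γ` is the Hecke operator of `γ⁻¹` (Shimura 1971, §3.1 Prop. 3.1, §3.4).  Plus the transport lemma
`IsFiniteCover.transferMap_congr`.  Cell pub-hodgecm2, lane «L-BYPASS» (kernel text by the seat
pub-hodgecm2-s2crux-idea-2, probe `RA-v33` Part K, gen 8; filed by b10).  Theorems only; no named fact.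

References: A. Hatcher, *Algebraic Topology* (2002), §3.G p. 321 and Prop. 3G.1 [HatcherAT2002]; G. Shimura,
*Introduction to the Arithmetic Theory of Automorphic Functions* (1971), §3.1 Prop. 3.1 and §3.4 (3.4.5) [Shimura1971].
-/

noncomputable section

open CategoryTheory

namespace Literature.AlgebraicTopology.SingularHomology.IsFiniteCover

universe u' v'

variable {R : Type v'} [CommRing R] [Algebra ℚ R]

/-- Transport of the normalised transfer along an equality of projections. [cite: HatcherAT2002, §3.G p. 321] -/
theorem transferMap_congr {E B : Type u'} [TopologicalSpace E] [TopologicalSpace B] {p p' : C(E, B)}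
    (c : IsFiniteCover p) (c' : IsFiniteCover p') (h : p = p') (n : ℕ) :
    c.transferMap (R := R) n = c'.transferMap (R := R) n := by
  subst h
  rfl

/-- **Transpose swap.**  For finite coverings `g = f₁' ∘ φ` and `f₁ = g' ∘ φ` through a finite covering `φ`
onto a preconnected space: `τ'_g ∘ f₁^* = τ'_{f₁'} ∘ g'^*` — from `τ'_{f₁'∘φ} = τ'_{f₁'} ∘ τ'_φ`
(`transferMap_comp`) and `τ'_φ ∘ φ^* = id` (normalised transfer, `transferMap_map`).
[cite: HatcherAT2002, §3.G p. 321 and Prop. 3G.1] -/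
theorem transferMap_comp_map_eq_of_comp {E E' B : Type u'} [TopologicalSpace E] [TopologicalSpace E']
    [TopologicalSpace B] [PreconnectedSpace E'] {f₁ g : C(E, B)} {f₁' g' : C(E', B)} {φ : C(E, E')}
    (cg : IsFiniteCover g) (cf : IsFiniteCover f₁') (cφ : IsFiniteCover φ)
    (hg : g = f₁'.comp φ) (hf : f₁ = g'.comp φ) (n : ℕ) :
    (cg.transferMap (R := R) n).hom ∘ₗ (singularCohomology.map R R f₁ n).hom =
      (cf.transferMap (R := R) n).hom ∘ₗ (singularCohomology.map R R g' n).hom := by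
  subst hg hf
  obtain ⟨d, hd⟩ := cφ.exists_ncard_fibre_eq
  refine LinearMap.ext fun y => ?_
  change cg.transferMap n (singularCohomology.map R R (g'.comp φ) n y) =
    cf.transferMap n (singularCohomology.map R R g' n y)
  rw [singularCohomology.map_comp, ModuleCat.comp_apply, IsFiniteCover.transferMap_comp cφ cf cg d hd,
    cφ.transferMap_map]

end Literature.AlgebraicTopology.SingularHomology.IsFiniteCover

end
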